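import Mathlib.Analysis.Calculus.IteratedDeriv.Lemmas
import Mathlib.Analysis.Calculus.MeanValue
import Mathlib.Algebra.Group.ForwardDiff
import HarnessLib

/-!
# Iterated forward differences are bounded by iterated derivatives

Topic `Literature/Analysis/Calculus`; the elementary bridge between the DISCRETE derivatives of a smooth symbol sampled
on a lattice (Benfatto–Giuliani–Mastropietro 2006, (2.36aa): `∂_{k_i} f = (L/2π)[f(k + (2π/L)e_i) - f(k)]` on the dual
torus) and its honest derivatives: `N` forward differences of step `h ≥ 0` are bounded by `h^N` times the supremum of
the `N`-th derivative on the sampled segment (the `N`-fold mean value theorem), and differences of a function of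
several variables along a vector `w` are differences of its restriction to the line `t ↦ k + t • w`.  With
`TorusFourierDecayFromDifferences.lean` this turns `Cᴺ` bounds of a symbol into position-space decay of its lattice
Fourier sum.

* **`norm_fwdDiff_iter_le_of_norm_iteratedDeriv_le`** — for `f : ℝ → E` of class `Cᴺ` and `h ≥ 0`:
  `‖(Δ_h^N f)(t)‖ ≤ h^N · K` whenever `‖f^{(N)}‖ ≤ K` on `[t, t + N h]`;
* `fwdDiff_iter_apply_add_smul` — `(Δ_w^N g)(k + t • w) = (Δ_1^N (s ↦ g(k + s • w)))(t)` on any real vector space;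
* **`norm_fwdDiff_iter_apply_le_of_line`** — hence `‖(Δ_w^N g)(k)‖ ≤ K` whenever the restriction of `g` to the line
  through `k` along `w` is `Cᴺ` with `N`-th derivative bounded by `K` on `[0, N]`.

Everything is proved; no definitions, no named facts. [folklore]

## Sources

G. Benfatto, A. Giuliani, V. Mastropietro, Ann. Henri Poincaré 7 (2006) 809–898, (2.36aa) and footnote ¹
(`BenfattoGiulianiMastropietro2006`).  Routine calculus ("folklore").
-/

noncomputable section

open Set

namespace Literature.Analysis.Calculus

variable {E : Type*} [NormedAddCommGroup E] [NormedSpace ℝ E]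

/-- **`N` forward differences are bounded by the `N`-th derivative** (the `N`-fold mean value theorem): for
`f : ℝ → E` of class `Cᴺ`, `h ≥ 0` and `‖f^{(N)}(s)‖ ≤ K` for `s ∈ [t, t + N h]`, `‖(Δ_h^N f)(t)‖ ≤ h^N · K`. [folklore] -/
theorem norm_fwdDiff_iter_le_of_norm_iteratedDeriv_le :
    ∀ (N : ℕ) (f : ℝ → E), ContDiff ℝ N f → ∀ {h : ℝ}, 0 ≤ h → ∀ (t : ℝ) {K : ℝ},
      (∀ s ∈ Icc t (t + N * h), ‖iteratedDeriv N f s‖ ≤ K) → ‖((fwdDiff h)^[N] f) t‖ ≤ h ^ N * K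
  | 0, f, _, h, _, t, K, hK => by
    simpa using hK t (by simp)
  | N + 1, f, hf, h, hh, t, K, hK => by
    rw [Function.iterate_succ_apply]
    -- the first difference is again smooth
    set g : ℝ → E := fwdDiff h f with hg
    have hshift : ContDiff ℝ (N + 1 : ℕ) (fun x => f (x + h)) := hf.comp (contDiff_id.add contDiff_const)
    have hgN1 : ContDiff ℝ (N + 1 : ℕ) g := hshift.sub hf
    have hgN : ContDiff ℝ N g := hgN1.of_le (by exact_mod_cast N.le_succ)
    have hfN : ContDiff ℝ N f := hf.of_le (by exact_mod_cast N.le_succ)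
    -- its `N`-th derivative is a first difference of `f^{(N)}`, bounded by `h K` (mean value theorem)
    have hderiv : ∀ s, iteratedDeriv N g s = iteratedDeriv N f (s + h) - iteratedDeriv N f s := by
      intro s
      rw [hg, show (fwdDiff h f : ℝ → E) = (fun x => f (x + h)) - f from rfl,
        iteratedDeriv_sub (hshift.of_le (by exact_mod_cast N.le_succ)).contDiffAt hfN.contDiffAt]
      simp only [iteratedDeriv_comp_add_const]
    have hdiff : Differentiable ℝ (iteratedDeriv N f) := hf.differentiable_iteratedDeriv' N
    have hbound : ∀ s ∈ Icc t (t + N * h), ‖iteratedDeriv N g s‖ ≤ h * K := by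
      intro s hs
      rw [hderiv]
      have hseg : ∀ x ∈ Icc s (s + h), ‖deriv (iteratedDeriv N f) x‖ ≤ K := by
        intro x hx
        rw [← iteratedDeriv_succ]
        refine hK x ⟨hs.1.trans hx.1, hx.2.trans ?_⟩
        push_cast
        linarith [hs.2]
      have hmvt := (convex_Icc s (s + h)).norm_image_sub_le_of_norm_deriv_le (fun x _ => hdiff x) hseg
        (left_mem_Icc.2 (by linarith)) (right_mem_Icc.2 (by linarith))
      rw [show s + h - s = h by ring, Real.norm_eq_abs, abs_of_nonneg hh, mul_comm] at hmvt
      exact hmvt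
    have ih := norm_fwdDiff_iter_le_of_norm_iteratedDeriv_le N g hgN hh t hbound
    calc ‖((fwdDiff h)^[N] g) t‖ ≤ h ^ N * (h * K) := ih
      _ = h ^ (N + 1) * K := by ring

/-- **Differences along a vector are differences of the restriction to the line**:
`(Δ_w^N g)(k + t • w) = (Δ_1^N (s ↦ g(k + s • w)))(t)`. [folklore] -/
theorem fwdDiff_iter_apply_add_smul {V : Type*} [AddCommGroup V] [Module ℝ V] {F : Type*} [AddCommGroup F]
    (k w : V) : ∀ (N : ℕ) (g : V → F) (t : ℝ),
      ((fwdDiff w)^[N] g) (k + t • w) = ((fwdDiff (1 : ℝ))^[N] fun s : ℝ => g (k + s • w)) t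
  | 0, g, t => rfl
  | N + 1, g, t => by
    rw [Function.iterate_succ_apply, Function.iterate_succ_apply, fwdDiff_iter_apply_add_smul k w N (fwdDiff w g) t]
    have hline : (fun s : ℝ => fwdDiff w g (k + s • w)) = fwdDiff (1 : ℝ) fun s : ℝ => g (k + s • w) := by
      funext s
      simp only [fwdDiff, add_smul, one_smul, add_assoc]
    rw [hline]

/-- **Differences along a vector are bounded by directional derivatives**: if the restriction `φ(s) = g(k + s • w)`
is `Cᴺ` with `‖φ^{(N)}(s)‖ ≤ K` for `s ∈ [0, N]`, then `‖(Δ_w^N g)(k)‖ ≤ K`. [folklore] -/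
theorem norm_fwdDiff_iter_apply_le_of_line {V : Type*} [AddCommGroup V] [Module ℝ V] (k w : V) (N : ℕ) (g : V → E)
    {K : ℝ} (hφ : ContDiff ℝ N fun s : ℝ => g (k + s • w))
    (hK : ∀ s ∈ Icc (0 : ℝ) N, ‖iteratedDeriv N (fun s : ℝ => g (k + s • w)) s‖ ≤ K) :
    ‖((fwdDiff w)^[N] g) k‖ ≤ K := by
  have h := norm_fwdDiff_iter_le_of_norm_iteratedDeriv_le N _ hφ zero_le_one 0 (K := K)
    (fun s hs => hK s (by simpa using hs))
  rw [one_pow, one_mul] at h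
  have e := fwdDiff_iter_apply_add_smul k w N g 0
  rw [zero_smul, add_zero] at e
  rw [e]
  exact h

end Literature.Analysis.Calculus
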